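import Mathlib
import HarnessLib
import Literature.Analysis.FluidPDE.HessianLaplacian
import Literature.Analysis.FluidPDE.RadialCalculus
import Literature.Analysis.FluidPDE.PressurePoisson
import Summits.NavierStokesRegularity.NavierStokesRegularity.Theorems.UnthreadedRigidityDoorUnthreadedRigidityHornPressureSource

/-!
# Route `UnthreadedRigidityDoor`, item `UnthreadedRigidity` (W2, stmt-NavierStokesRegularity-27585) — LINE g10-2 «PROFILE HORN»,
# BRIDGE PH (L-part `ThreadingJets.HornSliceIdentityTwo`), file 3: THE ANGULAR BASIS `S₂`, `S₄` AND THE RADIAL × HARMONIC LAPLACIAN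

Prover file (W2 Lean hand ns-crc-p1 g9, by lineage; `--supports stmt-NavierStokesRegularity-27585 --as helper`).  What the explicit pressure
`shellPressure` (`…HornPressureDefs`, p717811) needs of its angular factors, in Mathlib's Laplacian `Δ`:

* `isQuadForm_sqForm` (`(Q²)₀` is symmetric traceless), `fderiv_quadY_apply_self` (Euler `DY_M(z)·z = 2Y_M(z)`), `laplacian_quadY` (`ΔY_M = 0`,
  via `IsSolidHarmonic.divergence_gradient` + Literature `divergence_gradient`), `fderiv_quadY_basisFun`, `fderiv_norm_sq_basisFun`,
  `sum_coord_mul_fderiv_basisFun` (`Σᵢ zᵢ ∂ᵢS = DS(z)·z`);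
* `laplacian_norm_sq_mul_quadY` (`Δ(|z|² S₂) = 14 S₂`), `laplacian_quadY_sq` (`Δ(Y_Q²) = 8 zᵀQ²z`), `laplacian_norm_pow_four` (`Δ|z|⁴ = 20|z|²`),
  `contDiff_quartic`, ★ `laplacian_quartic` (`S₄ = quartic Q` IS HARMONIC: `8zᵀQ²z − (4/7)·14 S₂ − (2/15)tr Q²·20|z|² = 0`),
  `fderiv_quartic_apply_self` (Euler `DS₄(z)·z = 4 S₄(z)`);
* ★ `laplacian_radial_mul` — `Δ(β(|z|²)·S(z)) = (4|z|²β″ + (4L+6)β′)(|z|²)·S(z)` for smooth `β`, smooth `S` with `ΔS = 0` and `DS(z)·z = L S(z)`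
  (Literature `laplacian_mul_eq`, `laplacian_comp_norm_sq`).

HONEST LABEL: elementary multivariable calculus for the L-part of ONE bridge of a RUNG line about SPECIAL (separable `l = 2`) slice data;
`UnthreadedRigidity` (27585), W2 and NS regularity remain OPEN; nothing here is a statement about the Navier–Stokes equations.  0 kit.
-/

-- the summit and its single sub-problem share the name (CONVENTIONS §1), as in every Theorems file
set_option linter.dupNamespace false

noncomputable section

namespace Summit.NavierStokesRegularity.NavierStokesRegularity.Theorems.UnthreadedRigidity.HornPressure

open scoped RealInnerProductSpace Topology ContDiff Laplacian
open Filter Set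
open Literature.Analysis.FluidPDE
open Summit.NavierStokesRegularity.NavierStokesRegularity.Theorems.UnthreadedRigidity.ProfileHorn (E3 IsQuadForm quadY discrCubic)
open Summit.NavierStokesRegularity.NavierStokesRegularity.Theorems.UnthreadedRigidity.VirialHorn

/-! ## The angular basis: `S₂ = quadY (sqForm Q)` and `S₄ = quartic Q` are solid harmonics (what we need of it) -/

/-- the traceless square of a symmetric form is a quadratic form of `V₂` (symmetric, traceless). -/
theorem isQuadForm_sqForm {Q : Matrix (Fin 3) (Fin 3) ℝ} (hQ : Q.IsSymm) : IsQuadForm (sqForm Q) := by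
  constructor
  · unfold sqForm Matrix.IsSymm
    rw [Matrix.transpose_sub, Matrix.transpose_smul, Matrix.transpose_one, Matrix.transpose_mul, hQ]
  · unfold sqForm
    rw [Matrix.trace_sub, Matrix.trace_smul, Matrix.trace_one, Fintype.card_fin, smul_eq_mul]
    push_cast
    ring

/-- Euler identity for `Y_M`, any quadratic form `M`: `DY_M(z)·z = 2 Y_M(z)`. -/
theorem fderiv_quadY_apply_self {M : Matrix (Fin 3) (Fin 3) ℝ} (hM : IsQuadForm M) (z : E3) :
    fderiv ℝ (quadY M) z z = 2 * quadY M z := by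
  have := (isSolidHarmonic_quadY hM).fderiv_apply_self z
  simpa using this

/-- `Y_M` is harmonic for a quadratic form `M` (Mathlib's Laplacian). -/
theorem laplacian_quadY {M : Matrix (Fin 3) (Fin 3) ℝ} (hM : IsQuadForm M) (z : E3) : (Δ (quadY M)) z = 0 := by
  rw [← divergence_gradient ((isSolidHarmonic_quadY hM).contDiff.of_le (by norm_cast)) z]
  exact (isSolidHarmonic_quadY hM).divergence_gradient z

/-- the partial derivatives of `Y_Q` for symmetric `Q`: `∂ᵢ Y_Q(z) = 2 Σⱼ Q i j zⱼ`. -/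
theorem fderiv_quadY_basisFun {Q : Matrix (Fin 3) (Fin 3) ℝ} (hQ : Q.IsSymm) (z : E3) (i : Fin 3) :
    fderiv ℝ (quadY Q) z (EuclideanSpace.basisFun (Fin 3) ℝ i) = 2 * ∑ j : Fin 3, Q i j * z j := by
  have hs : ∀ i j : Fin 3, Q j i = Q i j := fun i j => by
    have := congrFun (congrFun hQ i) j
    simpa [Matrix.transpose_apply] using this
  rw [EuclideanSpace.basisFun_apply, fderiv_quadY_single]
  simp only [Fin.sum_univ_three, hs]
  ring

/-- the partial derivatives of `|z|²`: `∂ᵢ|z|² = 2 zᵢ`. -/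
theorem fderiv_norm_sq_basisFun (z : E3) (i : Fin 3) :
    fderiv ℝ (fun w : E3 => ‖w‖ ^ 2) z (EuclideanSpace.basisFun (Fin 3) ℝ i) = 2 * z i := by
  rw [(hasStrictFDerivAt_norm_sq z).hasFDerivAt.fderiv, EuclideanSpace.basisFun_apply]
  simp [EuclideanSpace.inner_single_right, two_smul]
  ring

/-- `DY(z)·z` recovered from the partials: `Σᵢ zᵢ ∂ᵢS = DS(z)·z`. -/
theorem sum_coord_mul_fderiv_basisFun (S : E3 → ℝ) (z : E3) :
    ∑ i : Fin 3, z i * fderiv ℝ S z (EuclideanSpace.basisFun (Fin 3) ℝ i) = fderiv ℝ S z z := by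
  have hz : z = ∑ i : Fin 3, z i • EuclideanSpace.basisFun (Fin 3) ℝ i := by
    simpa using ((EuclideanSpace.basisFun (Fin 3) ℝ).sum_repr z).symm
  have h := congrArg (fun v => fderiv ℝ S z v) hz
  simp only [map_sum, map_smul, smul_eq_mul] at h
  rw [h]

/-- `Δ(|z|²·S₂) = 14·S₂` for the quadratic form `S₂ = quadY M` (`M` a quad form): `6 S₂ + 4·(z·∇S₂)`. -/
theorem laplacian_norm_sq_mul_quadY {M : Matrix (Fin 3) (Fin 3) ℝ} (hM : IsQuadForm M) (z : E3) :
    (Δ (fun w : E3 => ‖w‖ ^ 2 * quadY M w)) z = 14 * quadY M z := by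
  have hn : ContDiff ℝ 2 (fun w : E3 => ‖w‖ ^ 2) := (contDiff_norm_sq ℝ).of_le (by norm_cast)
  have hY : ContDiff ℝ 2 (quadY M) := (isSolidHarmonic_quadY hM).contDiff.of_le (by norm_cast)
  rw [laplacian_mul_eq (EuclideanSpace.basisFun (Fin 3) ℝ) hn hY z, laplacian_quadY hM z, mul_zero, zero_add]
  have hrad : (Δ (fun w : E3 => ‖w‖ ^ 2)) z = 6 := by
    have h := laplacian_comp_norm_sq (E := E3) (g := fun σ => σ) (g₁ := fun _ => 1) (g₂ := 0) (z := z) isOpen_univ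
      (fun σ _ => hasDerivAt_id σ) (mem_univ _) (hasDerivAt_const _ _)
    simp only [finrank_euclideanSpace, Fintype.card_fin] at h
    rw [h]
    norm_num
  rw [hrad]
  simp only [fderiv_norm_sq_basisFun]
  have hsum : ∑ i : Fin 3, 2 * z i * fderiv ℝ (quadY M) z (EuclideanSpace.basisFun (Fin 3) ℝ i) =
      2 * fderiv ℝ (quadY M) z z := by
    rw [← sum_coord_mul_fderiv_basisFun, Finset.mul_sum]
    refine Finset.sum_congr rfl fun i _ => by ring
  rw [hsum, fderiv_quadY_apply_self hM]
  ring

/-- `Δ(Y_Q²) = 8 zᵀQ²z` (`= 2|∇Y_Q|²`), `Q` symmetric traceless. -/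
theorem laplacian_quadY_sq {Q : Matrix (Fin 3) (Fin 3) ℝ} (hQ : IsQuadForm Q) (z : E3) :
    (Δ (fun w : E3 => quadY Q w * quadY Q w)) z = 8 * ∑ i : Fin 3, (∑ j : Fin 3, Q i j * z j) ^ 2 := by
  have hY : ContDiff ℝ 2 (quadY Q) := (isSolidHarmonic_quadY hQ).contDiff.of_le (by norm_cast)
  rw [laplacian_mul_eq (EuclideanSpace.basisFun (Fin 3) ℝ) hY hY z, laplacian_quadY hQ z]
  simp only [mul_zero, zero_add, fderiv_quadY_basisFun hQ.1]
  rw [Finset.mul_sum, Finset.mul_sum]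
  refine Finset.sum_congr rfl fun i _ => by ring

/-- `Δ(|z|⁴) = 20 |z|²`. -/
theorem laplacian_norm_pow_four (z : E3) : (Δ (fun w : E3 => (‖w‖ ^ 2) ^ 2)) z = 20 * ‖z‖ ^ 2 := by
  have h := laplacian_comp_norm_sq (E := E3) (g := fun σ => σ ^ 2) (g₁ := fun σ => 2 * σ) (g₂ := 2) (z := z) isOpen_univ
    (fun σ _ => by simpa using hasDerivAt_pow 2 σ) (mem_univ _)
    (by simpa using (hasDerivAt_id (‖z‖ ^ 2)).const_mul (2:ℝ))
  simp only [finrank_euclideanSpace, Fintype.card_fin] at h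
  rw [h]
  push_cast
  ring

/-- `S₄ = quartic Q` is smooth. -/
theorem contDiff_quartic (Q : Matrix (Fin 3) (Fin 3) ℝ) (hQ : IsQuadForm Q) : ContDiff ℝ ∞ (quartic Q) := by
  have hY := (isSolidHarmonic_quadY hQ).contDiff
  have hS := (isSolidHarmonic_quadY (isQuadForm_sqForm hQ.1)).contDiff
  have hn : ContDiff ℝ ∞ (fun w : E3 => ‖w‖ ^ 2) := contDiff_norm_sq ℝ
  unfold quartic
  exact ((hY.pow 2).sub ((contDiff_const.mul hn).mul hS)).sub (contDiff_const.mul (hn.pow 2))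

/-- `S₄` IS HARMONIC: `Δ(quartic Q) = 8zᵀQ²z − (4/7)·14·S₂ − (2/15)·tr Q²·20|z|² = 0`. -/
theorem laplacian_quartic {Q : Matrix (Fin 3) (Fin 3) ℝ} (hQ : IsQuadForm Q) (z : E3) : (Δ (quartic Q)) z = 0 := by
  have hQ2 := isQuadForm_sqForm hQ.1
  have hY : ContDiff ℝ 2 (quadY Q) := (isSolidHarmonic_quadY hQ).contDiff.of_le (by norm_cast)
  have hS : ContDiff ℝ 2 (quadY (sqForm Q)) := (isSolidHarmonic_quadY hQ2).contDiff.of_le (by norm_cast)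
  have hn : ContDiff ℝ 2 (fun w : E3 => ‖w‖ ^ 2) := (contDiff_norm_sq ℝ).of_le (by norm_cast)
  have h1 : ContDiff ℝ 2 (fun w : E3 => quadY Q w * quadY Q w) := hY.mul hY
  have h2 : ContDiff ℝ 2 (fun w : E3 => ‖w‖ ^ 2 * quadY (sqForm Q) w) := hn.mul hS
  have h3 : ContDiff ℝ 2 (fun w : E3 => (‖w‖ ^ 2) ^ 2) := hn.pow 2
  have hfun : quartic Q = (fun w : E3 => quadY Q w * quadY Q w) - (4 / 7 : ℝ) • (fun w : E3 => ‖w‖ ^ 2 * quadY (sqForm Q) w)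
      - (2 / 15 * Matrix.trace (Q * Q)) • (fun w : E3 => (‖w‖ ^ 2) ^ 2) := by
    funext w
    simp only [quartic, Pi.sub_apply, Pi.smul_apply, smul_eq_mul]
    ring
  have h2' : ContDiff ℝ 2 ((4 / 7 : ℝ) • fun w : E3 => ‖w‖ ^ 2 * quadY (sqForm Q) w) := by
    have := h2.const_smul (4 / 7 : ℝ)
    simpa only [Pi.smul_def] using this
  have h3' : ContDiff ℝ 2 ((2 / 15 * Matrix.trace (Q * Q)) • fun w : E3 => (‖w‖ ^ 2) ^ 2) := by
    have := h3.const_smul (2 / 15 * Matrix.trace (Q * Q))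
    simpa only [Pi.smul_def] using this
  have h12 : ContDiff ℝ 2 ((fun w : E3 => quadY Q w * quadY Q w) - (4 / 7 : ℝ) • fun w : E3 => ‖w‖ ^ 2 * quadY (sqForm Q) w) := by
    have := h1.sub h2'
    simpa only [Pi.sub_def] using this
  rw [hfun, h12.contDiffAt.laplacian_sub h3'.contDiffAt, h1.contDiffAt.laplacian_sub h2'.contDiffAt,
    InnerProductSpace.laplacian_smul _ h2.contDiffAt, InnerProductSpace.laplacian_smul _ h3.contDiffAt,
    laplacian_quadY_sq hQ, laplacian_norm_sq_mul_quadY hQ2, laplacian_norm_pow_four, quadY_sqForm hQ.1]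
  simp only [smul_eq_mul]
  ring

/-- Euler identity for `S₄`: `D(quartic Q)(z)·z = 4·quartic Q z`. -/
theorem fderiv_quartic_apply_self {Q : Matrix (Fin 3) (Fin 3) ℝ} (hQ : IsQuadForm Q) (z : E3) :
    fderiv ℝ (quartic Q) z z = 4 * quartic Q z := by
  have hQ2 := isQuadForm_sqForm hQ.1
  have hY : HasFDerivAt (quadY Q) (fderiv ℝ (quadY Q) z) z :=
    (((isSolidHarmonic_quadY hQ).contDiff.differentiable (by simp)) z).hasFDerivAt
  have hS : HasFDerivAt (quadY (sqForm Q)) (fderiv ℝ (quadY (sqForm Q)) z) z :=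
    (((isSolidHarmonic_quadY hQ2).contDiff.differentiable (by simp)) z).hasFDerivAt
  have hN : HasFDerivAt (fun w : E3 => ‖w‖ ^ 2) (2 • innerSL ℝ z) z := (hasStrictFDerivAt_norm_sq z).hasFDerivAt
  have hq := ((hY.pow 2).sub ((hN.const_mul (4 / 7 : ℝ)).mul hS)).sub ((hN.pow 2).const_mul (2 / 15 * Matrix.trace (Q * Q)))
  have hq' : HasFDerivAt (quartic Q) _ z := hq.congr_of_eventuallyEq (Eventually.of_forall fun w => rfl)
  rw [hq'.fderiv]
  simp [fderiv_quadY_apply_self hQ, fderiv_quadY_apply_self hQ2, two_smul, quartic]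
  ring

/-- THE LAPLACIAN OF `β(|z|²)·S(z)` for a radial coefficient `β` and a smooth `S` with `ΔS = 0` and the Euler identity `DS(z)·z = L·S(z)`:
`Δ(β(|z|²) S) = (4|z|² β″ + (4L+6) β′)(|z|²) · S(z)` (`Δ(fg) = fΔg + gΔf + 2∇f·∇g`, `Δβ(|z|²) = 4sβ″ + 6β′`, `∇β(|z|²) = 2β′ z`). -/
theorem laplacian_radial_mul {β : ℝ → ℝ} (hβ : ContDiff ℝ ∞ β) {S : E3 → ℝ} (hS : ContDiff ℝ ∞ S) {L : ℝ}
    (hE : ∀ z : E3, fderiv ℝ S z z = L * S z) (hΔ : ∀ z : E3, (Δ S) z = 0) (z : E3) :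
    (Δ (fun w : E3 => β (‖w‖ ^ 2) * S w)) z =
      (4 * ‖z‖ ^ 2 * deriv (deriv β) (‖z‖ ^ 2) + (4 * L + 6) * deriv β (‖z‖ ^ 2)) * S z := by
  have hβd : Differentiable ℝ β := hβ.differentiable (by simp)
  have hβ'c : ContDiff ℝ ∞ (deriv β) := contDiff_deriv_of_contDiff_top hβ
  have hβ'd : Differentiable ℝ (deriv β) := hβ'c.differentiable (by simp)
  have hR : ContDiff ℝ 2 (fun w : E3 => β (‖w‖ ^ 2)) := (contDiff_radial hβ).of_le (by norm_cast)
  have hS2 : ContDiff ℝ 2 S := hS.of_le (by norm_cast)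
  rw [laplacian_mul_eq (EuclideanSpace.basisFun (Fin 3) ℝ) hR hS2 z, hΔ z, mul_zero, zero_add]
  have hrad : (Δ (fun w : E3 => β (‖w‖ ^ 2))) z = 4 * deriv (deriv β) (‖z‖ ^ 2) * ‖z‖ ^ 2 + 6 * deriv β (‖z‖ ^ 2) := by
    have h := laplacian_comp_norm_sq (E := E3) (g := β) (g₁ := deriv β) (g₂ := deriv (deriv β) (‖z‖ ^ 2)) (z := z)
      isOpen_univ (fun σ _ => (hβd σ).hasDerivAt) (mem_univ _) ((hβ'd _).hasDerivAt)
    simp only [finrank_euclideanSpace, Fintype.card_fin] at h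
    rw [h]
    norm_num
  have hN : HasFDerivAt (fun w : E3 => ‖w‖ ^ 2) (2 • innerSL ℝ z) z := (hasStrictFDerivAt_norm_sq z).hasFDerivAt
  have hfd : ∀ i : Fin 3, fderiv ℝ (fun w : E3 => β (‖w‖ ^ 2)) z (EuclideanSpace.basisFun (Fin 3) ℝ i) =
      2 * deriv β (‖z‖ ^ 2) * z i := by
    intro i
    have hc := (hβd (‖z‖ ^ 2)).hasDerivAt.comp_hasFDerivAt z hN
    have hc' : HasFDerivAt (fun w : E3 => β (‖w‖ ^ 2)) (deriv β (‖z‖ ^ 2) • (2 • innerSL ℝ z)) z :=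
      hc.congr_of_eventuallyEq (Eventually.of_forall fun w => rfl)
    rw [hc'.fderiv, EuclideanSpace.basisFun_apply]
    simp [EuclideanSpace.inner_single_right, two_smul]
    ring
  rw [hrad]
  simp only [hfd]
  have hsum : ∑ i : Fin 3, 2 * deriv β (‖z‖ ^ 2) * z i * fderiv ℝ S z (EuclideanSpace.basisFun (Fin 3) ℝ i) =
      2 * deriv β (‖z‖ ^ 2) * fderiv ℝ S z z := by
    rw [← sum_coord_mul_fderiv_basisFun, Finset.mul_sum]
    refine Finset.sum_congr rfl fun i _ => by ring
  rw [hsum, hE z]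
  ring

end Summit.NavierStokesRegularity.NavierStokesRegularity.Theorems.UnthreadedRigidity.HornPressure

end
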